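import Summits.AtomisticToContinuum.FouriersLaw.Theses.VanishingNoiseTransfer
import Summits.AtomisticToContinuum.FouriersLaw.Theses.JunctionLocality
import Literature.MathematicalPhysics.KineticTheory.VelocityFlipNoise
import Summits.AtomisticToContinuum.FouriersLaw.Theorems.VanishingNoiseTransferVanishingNoiseBoundFixedLengthNoiseContinuity
import Summits.AtomisticToContinuum.FouriersLaw.Theorems.VanishingNoiseTransferVanishingNoiseBoundNoisyPositiveConductance
import Summits.AtomisticToContinuum.FouriersLaw.Theorems.BoundedResponseConverges.Negative.OscillationExcluded
import Summits.AtomisticToContinuum.FouriersLaw.Theorems.FourierGreenKuboFourierFiniteResponseOfUnique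

/-!
# `VanishingNoiseBound` from the ε-uniform junction defect: the line `fekete-usc-one-length`, landed

`--supports stmt-AtomisticToContinuum-11976` file (crux `VanishingNoiseBound`, route `VanishingNoiseTransfer`). The durable form of
the crux line `fekete-usc-one-length` (skeleton `Cruxes/VanishingNoiseBound/Lines/fekete_usc_one_length.lean`, r6) after cycles 1–2:
with its fixed-`N` stubs PROVED — S2 `Theorems.FixedLengthNoiseContinuity.fixedLengthNoiseContinuity` (noise continuity of ONE chain's
response at `ε = 0⁺`, p98150) and S3 `flip_noisyPositiveConductance` (every finite noisy chain conducts, `…NoisyPositiveConductance.lean`)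
— the crux follows from its ONE remaining stub S1, the ε-UNIFORM JUNCTION DEFECT (spelled out as the hypothesis `hS1` below:
`∃ C ε₁ > 0, ∀ ε ∈ (0, ε₁]`, unique flip-steady family, responses `D_N(ε) > 0` ⇒ `R_N(ε) + R_M(ε) − C ≤ R_{N+M}(ε)`,
`R_N := (N−1)/D_N`), together with three registered route items taken BY NAME: stmt-9127 `JunctionLocality.NonBallistic`,
stmt-0741 `NessUnique`, stmt-0717 `FiniteResponseOfUnique`.

* `flip_eventually_le_of_superadditive_oneLength` — Fekete at one length (real analysis).
* `vanishingNoiseBound_of_noisyJunctionDefect` — **S1 → NonBallistic → NessUnique → FiniteResponseOfUnique → VanishingNoiseBound**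
  (`K = 2n`, `n` the one non-ballistic length at `ε = 0`; `ε₁ = min(ε₁(S1), ε₂(S2 at n))`).
* `superadditiveResistance_of_noisyJunctionDefect` — **S1 → NoisyFourier → JunctionLocality.SuperadditiveResistance** (stmt-11748):
  S1 is at least the open rank-2 crux stmt-11748 made uniform in the vanishing noise — the reason the line hands S1 back as crux-sized.

No `sorry`, no new definitions; S1 enters only as an explicit hypothesis.
-/

noncomputable section

open MeasureTheory Filter Topology
open Literature.MathematicalPhysics.KineticTheory.HeatConduction

namespace Summit.AtomisticToContinuum.FouriersLaw.Theorems.VanishingNoiseBound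

/-- **Fekete at one length.** If `D N > 0` (`N ≥ 2`), the resistances `R N := (N−1)/D N` are
superadditive up to `C` on `{N, M ≥ 2}`, and ONE length `n ≥ 2` has `R n ≥ 2|C| + 2`, then
`D N ≤ 2n` for all `N ≥ 2n + 1`. Proof: `a N := R N − C` is superadditive with `a n ≥ 1`; for
`N = q·n + r` (`2 ≤ r ≤ n + 1`), `a N ≥ q·a n + a r ≥ q − C` (as `R r > 0`), so `R N ≥ q ≥ (N−1)/(2n)`. -/
theorem flip_eventually_le_of_superadditive_oneLength {D : ℕ → ℝ} {C : ℝ} {n : ℕ} (hn : 2 ≤ n)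
    (hpos : ∀ N : ℕ, 2 ≤ N → 0 < D N)
    (hsup : ∀ N M : ℕ, 2 ≤ N → 2 ≤ M →
      ((N : ℝ) - 1) / D N + ((M : ℝ) - 1) / D M - C ≤ ((N : ℝ) + (M : ℝ) - 1) / D (N + M))
    (hbig : 2 * |C| + 2 ≤ ((n : ℝ) - 1) / D n) :
    ∀ᶠ N in atTop, D N ≤ 2 * (n : ℝ) := by
  -- the superadditive sequence `a N = R N - C`
  set a : ℕ → ℝ := fun N => ((N : ℝ) - 1) / D N - C with ha
  have hsa : ∀ p m : ℕ, 2 ≤ p → 2 ≤ m → a p + a m ≤ a (p + m) := by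
    intro p m hp hm
    have h := hsup p m hp hm
    simp only [ha]
    push_cast
    linarith
  have han : 1 ≤ a n := by
    have hC : C ≤ |C| := le_abs_self C
    have hC0 : 0 ≤ |C| := abs_nonneg C
    have e : a n = ((n : ℝ) - 1) / D n - C := rfl
    linarith
  refine eventually_atTop.2 ⟨2 * n + 1, fun N hN => ?_⟩
  have hN2 : 2 ≤ N := by omega
  -- Euclidean decomposition on the index semigroup `{N ≥ 2}`: `N = q n + r`, `2 ≤ r ≤ n + 1`
  obtain ⟨q, r, hNqr, hr2, hrn⟩ := boundedResponseConverges_fekete_decomp hN2 hn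
  -- Fekete iteration along the residue class: `q · a n + a r ≤ a N`
  have hiter := conductanceLowerBound_iter_superadditive hsa hn hr2 q
  rw [← hNqr] at hiter
  -- `a r ≥ -C` because `R r > 0`
  have hRr : 0 < ((r : ℝ) - 1) / D r := by
    have hr1 : (0 : ℝ) < (r : ℝ) - 1 := by
      have : (2 : ℝ) ≤ r := by exact_mod_cast hr2
      linarith
    exact div_pos hr1 (hpos r hr2)
  have har : -C ≤ a r := by
    have e : a r = ((r : ℝ) - 1) / D r - C := rfl
    linarith
  -- hence `R N ≥ q`
  have hRN : (q : ℝ) ≤ ((N : ℝ) - 1) / D N := by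
    have e : a N = ((N : ℝ) - 1) / D N - C := rfl
    have hq0 : (0 : ℝ) ≤ q := Nat.cast_nonneg q
    have hmul : (q : ℝ) * 1 ≤ (q : ℝ) * a n := mul_le_mul_of_nonneg_left han hq0
    linarith
  -- and `q ≥ (N - 1)/(2n)` since `q n = N - r ≥ N - n - 1` and `N ≥ 2n + 1`
  have hn0 : (0 : ℝ) < n := by exact_mod_cast (by omega : 0 < n)
  have hq : ((N : ℝ) - 1) / (2 * n) ≤ q := by
    rw [div_le_iff₀ (by positivity)]
    have h1 : (N : ℝ) = q * n + r := by exact_mod_cast hNqr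
    have h2 : (r : ℝ) ≤ n + 1 := by exact_mod_cast hrn
    have h3 : (2 * n + 1 : ℝ) ≤ N := by exact_mod_cast hN
    nlinarith
  -- so `(N-1)/(2n) ≤ (N-1)/D N`, i.e. `D N ≤ 2n`
  have hN1 : (0 : ℝ) < (N : ℝ) - 1 := by
    have : (2 : ℝ) ≤ N := by exact_mod_cast hN2
    linarith
  have h : ((N : ℝ) - 1) / (2 * n) ≤ ((N : ℝ) - 1) / D N := hq.trans hRN
  exact (div_le_div_iff_of_pos_left hN1 (by positivity) (hpos N hN2)).mp h

/-- **The crux from the ε-uniform junction defect.** `hS1` (stub S1 `stub_noisyJunctionDefect` of the line, verbatim) +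
`JunctionLocality.NonBallistic` (stmt-9127: at `ε = 0` the conductance `D_N(0)/(N−1)` is not bounded away from `0`) + `NessUnique`
(stmt-0741) + `FiniteResponseOfUnique` (stmt-0717) imply `VanishingNoiseTransfer.VanishingNoiseBound` with `K = 2n`, `n` the ONE
non-ballistic length chosen at `ε = 0`, and `ε₁ = min(ε₁(S1), ε₂(S2 at n))`: S3 makes `R_N(ε)` a resistance, S1 makes `R_N(ε) − C`
superadditive, NonBallistic + S2 give one length with `R_n(ε) ≥ 2|C| + 2`, Fekete at one length bounds `D_N(ε) ≤ 2n` eventually. -/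
theorem vanishingNoiseBound_of_noisyJunctionDefect
    (hS1 : ∀ ω₂ lam β γ : ℝ, 0 < ω₂ → 0 < lam → 0 < β → 0 < γ → ∀ T : ℝ, 0 < T →
            ∃ C ε₁ : ℝ, 0 < ε₁ ∧ ∀ ε : ℝ, 0 < ε → ε ≤ ε₁ →
              ∀ μ : (N : ℕ) → ℝ → ℝ → Measure (PhaseSpace N),
                (∀ (N : ℕ) (T_L T_R : ℝ), 0 < T_L → 0 < T_R →
                  (pinnedChain ω₂ lam β γ).IsFlipSteadyState N T_L T_R ε (μ N T_L T_R) ∧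
                    ∀ ν : Measure (PhaseSpace N),
                      (pinnedChain ω₂ lam β γ).IsFlipSteadyState N T_L T_R ε ν → ν = μ N T_L T_R) →
                ∀ D : ℕ → ℝ,
                  (∀ N : ℕ, Tendsto (fun δ : ℝ =>
                    (pinnedChain ω₂ lam β γ).totalCurrent (μ N (T + δ / 2) (T - δ / 2)) / δ)
                    (𝓝[≠] 0) (𝓝 (D N))) →
                  (∀ N : ℕ, 2 ≤ N → 0 < D N) →
                  ∀ N M : ℕ, 2 ≤ N → 2 ≤ M →
                    ((N : ℝ) - 1) / D N + ((M : ℝ) - 1) / D M - C ≤ ((N : ℝ) + (M : ℝ) - 1) / D (N + M))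
    (hNB : Theses.JunctionLocality.NonBallistic)
    (hU : Theses.VanishingNoiseTransfer.NessUnique)
    (hR : Theses.VanishingNoiseTransfer.FiniteResponseOfUnique) :
    Theses.VanishingNoiseTransfer.VanishingNoiseBound := by
  intro ω₂ lam β γ hω hl hβ hγ S hS T hT
  subst hS
  have huniq := hU ω₂ lam β γ hω hl hβ hγ
  -- (0) the unique deterministic steady family (landed existence theorem + NessUnique), by choice
  have hex : ∀ (N : ℕ) (T_L T_R : ℝ), 0 < T_L → 0 < T_R →
      ∃ μ : Measure (PhaseSpace N), (pinnedChain ω₂ lam β γ).IsSteadyState N T_L T_R μ :=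
    fun N T_L T_R hL hR' => pinnedChain_exists_isSteadyState hω hl hβ hγ N hL hR'
  classical
  let μ0 : (N : ℕ) → ℝ → ℝ → Measure (PhaseSpace N) := fun N T_L T_R =>
    if h : 0 < T_L ∧ 0 < T_R then Classical.choose (hex N T_L T_R h.1 h.2) else 0
  have hμ0 : ∀ (N : ℕ) (T_L T_R : ℝ), 0 < T_L → 0 < T_R →
      (pinnedChain ω₂ lam β γ).IsSteadyState N T_L T_R (μ0 N T_L T_R) := by
    intro N T_L T_R hL hR'
    simp only [μ0, dif_pos (And.intro hL hR')]
    exact Classical.choose_spec (hex N T_L T_R hL hR')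
  -- its finite-N responses at `T` (FiniteResponseOfUnique)
  have hD0ex := hR ω₂ lam β γ hω hl hβ hγ huniq μ0 hμ0 T hT
  choose D0 hD0 using hD0ex
  -- (1) S1: the ε-uniform junction constant
  obtain ⟨C, ε₁, hε₁, hS1⟩ := hS1 ω₂ lam β γ hω hl hβ hγ T hT
  have hA : (0 : ℝ) < 2 * |C| + 2 := by positivity
  -- (2) NonBallistic at ε = 0: ONE length `n ≥ 2` with `D_n(0) ≤ (n-1)/(4A)`
  obtain ⟨n, hn2, hn⟩ := hNB ω₂ lam β γ hω hl hβ hγ huniq μ0 hμ0 T hT D0 hD0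
    (1 / (4 * (2 * |C| + 2))) (by positivity) 2
  have hn1 : (0 : ℝ) < (n : ℝ) - 1 := by
    have : (2 : ℝ) ≤ n := by exact_mod_cast hn2
    linarith
  -- (3) S2 at the single length `n`, tolerance `η := (n-1)/(4A)`
  set η : ℝ := ((n : ℝ) - 1) / (4 * (2 * |C| + 2)) with hη
  have hηpos : 0 < η := by
    rw [hη]
    exact div_pos hn1 (by positivity)
  obtain ⟨ε₂, hε₂, hS2⟩ := FixedLengthNoiseContinuity.fixedLengthNoiseContinuity ω₂ lam β γ hω hl hβ hγ T hT n (μ0 n)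
    (fun T_L T_R hL hR' => ⟨hμ0 n T_L T_R hL hR',
      fun ν hν => huniq n T_L T_R hL hR' ν _ hν (hμ0 n T_L T_R hL hR')⟩)
    (D0 n) (hD0 n) η hηpos
  -- (4) the crux's constants: K := 2n, ε₁ := min ε₁ ε₂
  refine ⟨2 * (n : ℝ), min ε₁ ε₂, lt_min hε₁ hε₂, ?_⟩
  intro ε hε hεle μ hμ D k hD hk
  have hεle₁ : ε ≤ ε₁ := hεle.trans (min_le_left _ _)
  have hεle₂ : ε ≤ ε₂ := hεle.trans (min_le_right _ _)
  -- the family hypothesis IS the named flip-steady predicate (`isFlipSteadyState_fun_eq`, by `rfl`)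
  have hμ' : ∀ (N : ℕ) (T_L T_R : ℝ), 0 < T_L → 0 < T_R →
      (pinnedChain ω₂ lam β γ).IsFlipSteadyState N T_L T_R ε (μ N T_L T_R) ∧
        ∀ ν : Measure (PhaseSpace N),
          (pinnedChain ω₂ lam β γ).IsFlipSteadyState N T_L T_R ε ν → ν = μ N T_L T_R := hμ
  -- S3: positivity; S1: superadditivity at this ε
  have hpos : ∀ N : ℕ, 2 ≤ N → 0 < D N :=
    flip_noisyPositiveConductance ω₂ lam β γ hω hl hβ hγ T hT ε hε μ hμ' D hD
  have hsup := hS1 ε hε hεle₁ μ hμ' D hD hpos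
  -- S2 at length n: `D_n(ε) ≤ D_n(0) + η ≤ 2η = (n-1)/(2A)`
  have hclose : |D n - D0 n| ≤ η := hS2 ε hε hεle₂ (μ n) (hμ' n) (D n) (hD n)
  have hDn : D n ≤ 2 * η := by
    have h1 := (abs_le.mp hclose).2
    have e1 : 1 / (4 * (2 * |C| + 2)) * ((n : ℝ) - 1) = η := by
      rw [hη]
      ring
    rw [e1] at hn
    linarith
  -- hence ONE big resistance: `2|C| + 2 ≤ R_n(ε)`
  have hA' : (2 * |C| + 2) ≠ 0 := hA.ne'
  have hbig : 2 * |C| + 2 ≤ ((n : ℝ) - 1) / D n := by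
    rw [le_div_iff₀ (hpos n hn2)]
    have h1 : (2 * |C| + 2) * D n ≤ (2 * |C| + 2) * (2 * η) := mul_le_mul_of_nonneg_left hDn hA.le
    have e : (2 * |C| + 2) * (2 * η) = ((n : ℝ) - 1) / 2 := by
      rw [hη]
      field_simp
      ring
    linarith
  -- Fekete at one length: `D_N(ε) ≤ 2n` eventually, so `k ≤ 2n`
  exact le_of_tendsto hk (flip_eventually_le_of_superadditive_oneLength hn2 hpos hsup hbig)

/-- **S1 relocates stmt-11748.** Given the sibling crux `NoisyFourier` (at every rate THE unique noisy family exists and has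
responses), the ε-uniform junction defect `hS1` implies `JunctionLocality.SuperadditiveResistance` (stmt-AtomisticToContinuum-11748)
with the SAME constant `C`: at fixed `N, M ≥ 2` take rates `ε_k = ε₁/(k+1) ↓ 0`; S3 + S1 give the inequality at every `k`; S2 at the
three lengths `N, M, N+M` gives `D^{ε_k}_L → D⁰_L > 0`; pass to the limit. -/
theorem superadditiveResistance_of_noisyJunctionDefect
    (hS1 : ∀ ω₂ lam β γ : ℝ, 0 < ω₂ → 0 < lam → 0 < β → 0 < γ → ∀ T : ℝ, 0 < T →
            ∃ C ε₁ : ℝ, 0 < ε₁ ∧ ∀ ε : ℝ, 0 < ε → ε ≤ ε₁ →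
              ∀ μ : (N : ℕ) → ℝ → ℝ → Measure (PhaseSpace N),
                (∀ (N : ℕ) (T_L T_R : ℝ), 0 < T_L → 0 < T_R →
                  (pinnedChain ω₂ lam β γ).IsFlipSteadyState N T_L T_R ε (μ N T_L T_R) ∧
                    ∀ ν : Measure (PhaseSpace N),
                      (pinnedChain ω₂ lam β γ).IsFlipSteadyState N T_L T_R ε ν → ν = μ N T_L T_R) →
                ∀ D : ℕ → ℝ,
                  (∀ N : ℕ, Tendsto (fun δ : ℝ =>
                    (pinnedChain ω₂ lam β γ).totalCurrent (μ N (T + δ / 2) (T - δ / 2)) / δ)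
                    (𝓝[≠] 0) (𝓝 (D N))) →
                  (∀ N : ℕ, 2 ≤ N → 0 < D N) →
                  ∀ N M : ℕ, 2 ≤ N → 2 ≤ M →
                    ((N : ℝ) - 1) / D N + ((M : ℝ) - 1) / D M - C ≤ ((N : ℝ) + (M : ℝ) - 1) / D (N + M))
    (hNF : Theses.VanishingNoiseTransfer.NoisyFourier) :
    Theses.JunctionLocality.SuperadditiveResistance := by
  intro ω₂ lam β γ hω hl hβ hγ huniq μ hμ T hT D hD hDpos
  obtain ⟨C, ε₁, hε₁, hS1⟩ := hS1 ω₂ lam β γ hω hl hβ hγ T hT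
  refine ⟨C, fun N M hN hM => ?_⟩
  -- rates ε_k = ε₁/(k+1) ↓ 0 inside (0, ε₁]
  have hεpos : ∀ k : ℕ, 0 < ε₁ * (1 / ((k : ℝ) + 1)) := fun k => by positivity
  have hεle : ∀ k : ℕ, ε₁ * (1 / ((k : ℝ) + 1)) ≤ ε₁ := fun k => by
    refine mul_le_of_le_one_right hε₁.le ?_
    rw [div_le_one (by positivity)]
    linarith [(Nat.cast_nonneg k : (0 : ℝ) ≤ k)]
  have hεlim : Tendsto (fun k : ℕ => ε₁ * (1 / ((k : ℝ) + 1))) atTop (𝓝 0) := by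
    simpa using tendsto_one_div_add_atTop_nhds_zero_nat.const_mul ε₁
  -- NoisyFourier at each rate: THE unique noisy family (by choice) and its responses at `T`
  have hNFk : ∀ k : ℕ, ∃ (μk : (L : ℕ) → ℝ → ℝ → Measure (PhaseSpace L)) (Dk : ℕ → ℝ),
      (∀ (L : ℕ) (T_L T_R : ℝ), 0 < T_L → 0 < T_R →
        (pinnedChain ω₂ lam β γ).IsFlipSteadyState L T_L T_R (ε₁ * (1 / ((k : ℝ) + 1))) (μk L T_L T_R) ∧
          ∀ ν : Measure (PhaseSpace L),
            (pinnedChain ω₂ lam β γ).IsFlipSteadyState L T_L T_R (ε₁ * (1 / ((k : ℝ) + 1))) ν →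
              ν = μk L T_L T_R) ∧
      ∀ L : ℕ, Tendsto (fun δ : ℝ =>
        (pinnedChain ω₂ lam β γ).totalCurrent (μk L (T + δ / 2) (T - δ / 2)) / δ)
        (𝓝[≠] 0) (𝓝 (Dk L)) := by
    intro k
    obtain ⟨hexu, κ, -, hresp⟩ := hNF ω₂ lam β γ hω hl hβ hγ _ rfl _ (hεpos k)
    classical
    let μk : (L : ℕ) → ℝ → ℝ → Measure (PhaseSpace L) := fun L T_L T_R =>
      if h : 0 < T_L ∧ 0 < T_R then (hexu L T_L T_R h.1 h.2).choose else 0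
    have hμk : ∀ (L : ℕ) (T_L T_R : ℝ), 0 < T_L → 0 < T_R →
        (pinnedChain ω₂ lam β γ).IsFlipSteadyState L T_L T_R (ε₁ * (1 / ((k : ℝ) + 1))) (μk L T_L T_R) ∧
          ∀ ν : Measure (PhaseSpace L),
            (pinnedChain ω₂ lam β γ).IsFlipSteadyState L T_L T_R (ε₁ * (1 / ((k : ℝ) + 1))) ν →
              ν = μk L T_L T_R := by
      intro L T_L T_R hL hR'
      simp only [μk, dif_pos (And.intro hL hR')]
      exact (hexu L T_L T_R hL hR').choose_spec
    obtain ⟨Dk, hDk, -⟩ := hresp μk (fun L T_L T_R hL hR' => (hμk L T_L T_R hL hR').1) T hT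
    exact ⟨μk, Dk, hμk, hDk⟩
  choose μk Dk hμk hDk using hNFk
  -- S3 (positivity) and S1 (superadditivity, same `C`) at every rate
  have hposk : ∀ k : ℕ, ∀ L : ℕ, 2 ≤ L → 0 < Dk k L := fun k =>
    flip_noisyPositiveConductance ω₂ lam β γ hω hl hβ hγ T hT _ (hεpos k) (μk k) (hμk k) (Dk k) (hDk k)
  have hsupk : ∀ k : ℕ, ((N : ℝ) - 1) / Dk k N + ((M : ℝ) - 1) / Dk k M - C ≤
      ((N : ℝ) + (M : ℝ) - 1) / Dk k (N + M) := fun k =>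
    hS1 _ (hεpos k) (hεle k) (μk k) (hμk k) (Dk k) (hDk k) (hposk k) N M hN hM
  -- S2 at a fixed length: the noisy responses converge to the deterministic one along ε_k
  have hconv : ∀ L : ℕ, Tendsto (fun k : ℕ => Dk k L) atTop (𝓝 (D L)) := by
    intro L
    rw [Metric.tendsto_atTop]
    intro η hη
    obtain ⟨ε₂, hε₂, hS2⟩ := FixedLengthNoiseContinuity.fixedLengthNoiseContinuity ω₂ lam β γ hω hl hβ hγ T hT L (μ L)
      (fun T_L T_R hL hR' => ⟨hμ L T_L T_R hL hR',
        fun ν hν => huniq L T_L T_R hL hR' ν _ hν (hμ L T_L T_R hL hR')⟩)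
      (D L) (hD L) (η / 2) (by positivity)
    obtain ⟨k₀, hk₀⟩ := eventually_atTop.1 (hεlim.eventually_lt_const hε₂)
    refine ⟨k₀, fun k hk => ?_⟩
    have h := hS2 _ (hεpos k) (hk₀ k hk).le (μk k L) (hμk k L) (Dk k L) (hDk k L)
    rw [Real.dist_eq]
    exact lt_of_le_of_lt h (by linarith)
  -- hence the resistances converge at the three lengths (`D L > 0`) and the inequality passes to the limit
  have hRlim : ∀ L : ℕ, 2 ≤ L → ∀ c : ℝ,
      Tendsto (fun k : ℕ => c / Dk k L) atTop (𝓝 (c / D L)) := fun L hL c =>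
    tendsto_const_nhds.div (hconv L) (hDpos L hL).ne'
  have hNM : 2 ≤ N + M := by omega
  have hlim₁ : Tendsto (fun k : ℕ => ((N : ℝ) - 1) / Dk k N + ((M : ℝ) - 1) / Dk k M - C) atTop
      (𝓝 (((N : ℝ) - 1) / D N + ((M : ℝ) - 1) / D M - C)) :=
    ((hRlim N hN _).add (hRlim M hM _)).sub_const C
  have hlim₂ : Tendsto (fun k : ℕ => ((N : ℝ) + (M : ℝ) - 1) / Dk k (N + M)) atTop
      (𝓝 (((N : ℝ) + (M : ℝ) - 1) / D (N + M))) := hRlim (N + M) hNM _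
  exact le_of_tendsto_of_tendsto hlim₁ hlim₂ (Eventually.of_forall hsupk)

/-! ## Registered helper -/

/-- Registered helper sub-goal `helper_vanishingNoiseBoundOfNoisyJunctionDefect` of crux stmt-AtomisticToContinuum-11976 (line
`fekete-usc-one-length`): the crux from its one remaining stub S1 and the three by-name route items
(`vanishingNoiseBound_of_noisyJunctionDefect`). -/
theorem helper_vanishingNoiseBoundOfNoisyJunctionDefect : (∀ ω₂ lam β γ : ℝ, 0 < ω₂ → 0 < lam → 0 < β → 0 < γ → ∀ T : ℝ, 0 < T → ∃ C ε₁ : ℝ, 0 < ε₁ ∧ ∀ ε : ℝ, 0 < ε → ε ≤ ε₁ → ∀ μ : (N : ℕ) → ℝ → ℝ → Measure (PhaseSpace N), (∀ (N : ℕ) (T_L T_R : ℝ), 0 < T_L → 0 < T_R → (pinnedChain ω₂ lam β γ).IsFlipSteadyState N T_L T_R ε (μ N T_L T_R) ∧ ∀ ν : Measure (PhaseSpace N), (pinnedChain ω₂ lam β γ).IsFlipSteadyState N T_L T_R ε ν → ν = μ N T_L T_R) → ∀ D : ℕ → ℝ, (∀ N : ℕ, Tendsto (fun δ : ℝ =>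 (pinnedChain ω₂ lam β γ).totalCurrent (μ N (T + δ / 2) (T - δ / 2)) / δ) (𝓝[≠] 0) (𝓝 (D N))) → (∀ N : ℕ, 2 ≤ N → 0 < D N) → ∀ N M : ℕ, 2 ≤ N → 2 ≤ M → ((N : ℝ) - 1) / D N + ((M : ℝ) - 1) / D M - C ≤ ((N : ℝ) + (M : ℝ) - 1) / D (N + M)) → Theses.JunctionLocality.NonBallistic → Theses.VanishingNoiseTransfer.NessUnique → Theses.VanishingNoiseTransfer.FiniteResponseOfUnique → Theses.VanishingNoiseTransfer.VanishingNoiseBound :=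
  vanishingNoiseBound_of_noisyJunctionDefect

/-! ## r7 (continuation lead c2): the two closed by-name route inputs discharged

Items stmt-AtomisticToContinuum-0741 `NessUnique` and stmt-AtomisticToContinuum-0717 `FiniteResponseOfUnique` are CLOSED
(`Theses.VanishingNoiseTransfer.NessUnique_holds`; `Theorems.FourierGreenKubo.finiteResponse_of_unique`, whose signature is
this route's decl verbatim). Hence the line reads `VanishingNoiseBound ⟸ S1 ∧ NonBallistic (stmt-9127)`. -/

/-- **`VanishingNoiseTransfer.FiniteResponseOfUnique` holds** (route item stmt-AtomisticToContinuum-0717, closed): this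
route's verbatim copy of the finite-`N` response-existence decl, by the landed
`Theorems.FourierGreenKubo.finiteResponse_of_unique` (open-chain Green–Kubo identity for `N ≥ 2`; no current for
`N ≤ 1`). [cite: KunduDharNarayan2009, p. 3] -/
theorem vnt_finiteResponseOfUnique_holds : Theses.VanishingNoiseTransfer.FiniteResponseOfUnique :=
  Theorems.FourierGreenKubo.finiteResponse_of_unique

/-- **The crux from S1 and `NonBallistic` alone (r7).** The ε-uniform junction defect `hS1` (stub S1
`stub_noisyJunctionDefect`, verbatim) and `JunctionLocality.NonBallistic` (stmt-9127) imply
`VanishingNoiseTransfer.VanishingNoiseBound`: `vanishingNoiseBound_of_noisyJunctionDefect` with its two other by-name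
inputs discharged by the closed items stmt-0741 (`NessUnique_holds`) and stmt-0717 (`vnt_finiteResponseOfUnique_holds`). -/
theorem vanishingNoiseBound_of_noisyJunctionDefect_of_nonBallistic
    (hS1 : ∀ ω₂ lam β γ : ℝ, 0 < ω₂ → 0 < lam → 0 < β → 0 < γ → ∀ T : ℝ, 0 < T →
            ∃ C ε₁ : ℝ, 0 < ε₁ ∧ ∀ ε : ℝ, 0 < ε → ε ≤ ε₁ →
              ∀ μ : (N : ℕ) → ℝ → ℝ → Measure (PhaseSpace N),
                (∀ (N : ℕ) (T_L T_R : ℝ), 0 < T_L → 0 < T_R →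
                  (pinnedChain ω₂ lam β γ).IsFlipSteadyState N T_L T_R ε (μ N T_L T_R) ∧
                    ∀ ν : Measure (PhaseSpace N),
                      (pinnedChain ω₂ lam β γ).IsFlipSteadyState N T_L T_R ε ν → ν = μ N T_L T_R) →
                ∀ D : ℕ → ℝ,
                  (∀ N : ℕ, Tendsto (fun δ : ℝ =>
                    (pinnedChain ω₂ lam β γ).totalCurrent (μ N (T + δ / 2) (T - δ / 2)) / δ)
                    (𝓝[≠] 0) (𝓝 (D N))) →
                  (∀ N : ℕ, 2 ≤ N → 0 < D N) →
                  ∀ N M : ℕ, 2 ≤ N → 2 ≤ M →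
                    ((N : ℝ) - 1) / D N + ((M : ℝ) - 1) / D M - C ≤ ((N : ℝ) + (M : ℝ) - 1) / D (N + M))
    (hNB : Theses.JunctionLocality.NonBallistic) :
    Theses.VanishingNoiseTransfer.VanishingNoiseBound :=
  vanishingNoiseBound_of_noisyJunctionDefect hS1 hNB Theses.VanishingNoiseTransfer.NessUnique_holds
    vnt_finiteResponseOfUnique_holds

/-- Registered helper sub-goal `helper_vanishingNoiseBoundOfS1NonBallistic` of crux stmt-AtomisticToContinuum-11976 (line
`fekete-usc-one-length`, r7): the crux from its one remaining stub S1 and the one open by-name route item stmt-9127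
(`vanishingNoiseBound_of_noisyJunctionDefect_of_nonBallistic`). -/
theorem helper_vanishingNoiseBoundOfS1NonBallistic : (∀ ω₂ lam β γ : ℝ, 0 < ω₂ → 0 < lam → 0 < β → 0 < γ → ∀ T : ℝ, 0 < T → ∃ C ε₁ : ℝ, 0 < ε₁ ∧ ∀ ε : ℝ, 0 < ε → ε ≤ ε₁ → ∀ μ : (N : ℕ) → ℝ → ℝ → Measure (PhaseSpace N), (∀ (N : ℕ) (T_L T_R : ℝ), 0 < T_L → 0 < T_R → (pinnedChain ω₂ lam β γ).IsFlipSteadyState N T_L T_R ε (μ N T_L T_R) ∧ ∀ ν : Measure (PhaseSpace N), (pinnedChain ω₂ lam β γ).IsFlipSteadyState N T_L T_R ε ν → ν = μ N T_L T_R) → ∀ D : ℕ → ℝ, (∀ N : ℕ, Tendsto (fun δ : ℝ => (pinnedChain ω₂ lam β γ).totalCurrent (μ N (T + δ / 2) (T - δ / 2)) / δ) (𝓝[≠] 0) (𝓝 (D N))) → (∀ N : ℕ, 2 ≤ N → 0 < D N) → ∀ N M : ℕ, 2 ≤ N → 2 ≤ M → ((N : ℝ) - 1) / D N + ((M : ℝ)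 - 1) / D M - C ≤ ((N : ℝ) + (M : ℝ) - 1) / D (N + M)) → Theses.JunctionLocality.NonBallistic → Theses.VanishingNoiseTransfer.VanishingNoiseBound :=
  vanishingNoiseBound_of_noisyJunctionDefect_of_nonBallistic

end Summit.AtomisticToContinuum.FouriersLaw.Theorems.VanishingNoiseBound

end
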